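import Summits.BirchSwinnertonDyer.BirchSwinnertonDyer.Theorems.ResidualThetaTransportAtTwoRlfTwistedLocalZpExtension
import Literature.NumberTheory.EllipticCurves.Greenberg1999.LocalQuotientControlSurjectiveProofs
import Literature.NumberTheory.EllipticCurves.ZpExtensionGaloisTwistLocal
import Literature.NumberTheory.EllipticCurves.KummerSelmerStructure
import Literature.NumberTheory.GaloisRepresentations.ContinuousCohomologyConnecting
import HarnessLib

/-!
# (R4) = (LOC-S₀) of road T for item 23110: the TWISTED local `Γ`-descent at a place `v ∤ p` —
# a `p`-power-torsion class of `𝒫_v = H¹(Gal(K̄_v/(K_∞)_η), E(K̄_v))` which is an eigenvector `u^N · conj_g z = z` of a local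
# generator `g ↦ γ^N` is the image of a class of `H¹(Γ_{K_v}, E[p^J](χ_u))` for every large `J`

Route `ResidualThetaTransportAtTwo` (RTT, crux r201 `ResidualLambdaFormulaNegDiscAtTwo`, stmt-BirchSwinnertonDyer-23110) /
`ThetaPartnerAtTwo` (TP2, aside r205). Seat `prover-bsd-wall-tp2-p2x-w3` g12 (width of the K3 lead tp2-p2x g12, who holds 23110 and
whose memo RLF-TWIST-ROAD-g12 §3 lists this as brick (R4)); `--supports stmt-BirchSwinnertonDyer-23110`. THEOREMS ONLY (no definition,
no named fact, no `sorry`); closes nothing.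

WHAT. The lead's `SignedEC.TwistedSurj.twistedCassels_sharp_of_level` (`…RlfTwistedCasselsOfLevel`) reduces the twisted Cassels♯
input (TCAS♯) of road T to the level-`K` statement (TCAS-K) plus its LOCAL hypothesis `hloc` = (LOC-S₀): for `v ∈ S₀` (`v ∤ p`), every
`p`-power-torsion `z ∈ 𝒫_v = discreteH1 (localSubgroup (ker κ) K_v) (localPoints W K_v)` with `u ^ N v • conj_{g v} z = z` is
`twistedTorsionToLocalH1 t` for some `t ∈ H¹(Γ_{K_v}, E[p^J](χ_u))`, for all `J ≥ J₀`. THIS FILE proves it for every local datum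
`(N, g)` that is ADMISSIBLE (`κ(g|_{K̄}) = N`, i.e. `γ^N ∈ ker κ · g|_{K̄}`, `apply_eq_ofAdd_of_pow_eq_mul`) and GENERATING (the
coordinate `κ(g|_{K̄})` has maximal norm on `Γ_{K_v}`: `g` topologically generates `Gal((K_∞)_η/K_v)`; for the cyclotomic
`ℤ₂`-extension of `ℚ` and `N_v = 2^{v₂((ℓ_v²−1)/8)}` this is the count of primes above `ℓ_v`, the assembler's (R6) input).
Any number field `K`, prime `p`, `ℤ_p`-extension `κ`, `u ≡ 1 (mod p)`, finite `v ∤ p`.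

PROOF (Greenberg p. 108 «`Gal((F_∞)_η/(F_n)_{v_n})` has `p`-cohomological dimension `1`» and p. 124, on cocycles; the UNTWISTED twin
is the tree's `Greenberg1999.exists_primary_resOfLe_eq_of_forall_conjH1_eq`, re-run with the twist factor `u^N`): (1) the local
`ℤ_p`-extension `κ_v` of `K_v` with `ker κ_v = Gal(K̄_v/(K_∞)_η)` and topological generator THE GIVEN `g` (rescale `κ(·|_{K̄})` by
its value at `g`); (2) `z = [φ]`, `p^k φ = ∂Q`, `Q = p^k Q'`, `f = φ − ∂Q'` is `p^k`-torsion-valued; (3) the eigenvector condition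
gives `u^N · g f(g⁻¹τg) − f(τ) = ∂P₀` on `Gal(K̄_v/(K_∞)_η)`, `p^k P₀ ∈ E((K_∞)_η)`; (4) KUMMER VANISHING at `v ∤ p`
(`Greenberg1999.exists_sub_smul_mem_primaryComponent_fixedPoints_localSubgroup`) replaces `P₀` by a `p`-power-torsion `P'`,
`J₀ := k + (exponent of P')`; (5) for `J ≥ J₀` transport `f`, `P'` into `E[p^J](K̄) ≃ E(K̄_v)[p^J]` (`torsionPointsEquiv`) with the
TWISTED action of `Γ_{K_v}` (`χ_u(g) = u^{N mod p^J}`, `χ_u ≡ 1` on `ker κ_v`): (3) is then the hypothesis of the tree's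
`ZpExtension.exists_extend` (`cd_p ℤ_p = 1` on cocycles) for `κ_v`, `g`, level `0`; the extended twisted cocycle is `t`, and
`twistedTorsionToLocalH1 t = [f] = [φ] = z` (`twistedTorsionToLocalH1_oneCocycleClass`, `pointsMap_torsionPointsEquiv_symm`).

* `exists_twistedTorsionToLocalH1_eq_of_zsmul_conjH1_eq` — (R4) = (LOC-S₀) for admissible generating `(N, g)` (step (1) and the
  twist exponent of `g` are in `…RlfTwistedLocalZpExtension`).

HONEST FRAMING: closes nothing; (TCAS-K), (LIFT), (R1)–(R3), (R5)–(R6) of the memo are untouched; 23110 is NOT proved; BSD is not proved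
by any of this.
References: [GreenbergLNM1716] §4 proof of Lemma 4.7 (p. 108), Prop. 4.13 and Remark (pp. 122–124); §2 Prop. 2.1 (p. 72); §3 Lemma 3.3
(p. 87); [SerreGaloisCohomology1997] I §2.6 (b), I §3.4, I §5; [Washington1997] §13.1–§13.2.
-/

set_option autoImplicit false
-- the Theorems namespace of this sub repeats the summit name by design (D-0017 nested layout)
set_option linter.dupNamespace false

noncomputable section

open scoped Classical NNReal

open NumberField IsDedekindDomain Field CategoryTheory

universe u

namespace Summit.BirchSwinnertonDyer.BirchSwinnertonDyer.Theorems.SignedEC.TwistedLocalDescent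

open Literature.NumberTheory.EllipticCurves Literature.NumberTheory.GaloisRepresentations
  Literature.NumberTheory.EllipticCurves.ZpExtension WeierstrassCurve

/-! ## §3 The twisted local `Γ`-descent at `v ∤ p` -/

variable {K : Type u} [Field K] [NumberField K] (W : WeierstrassCurve K) [W.IsElliptic]
  {p : ℕ} [Fact p.Prime] (κ : ZpExtension K p)

set_option maxHeartbeats 3200000 in
/-- **(R4) = (LOC-S₀): twisted local `Γ`-descent at `v ∤ p`.** `K` a number field, `E = W/K` elliptic, `p` prime, `κ` ANY
`ℤ_p`-extension of `K`, `u ≡ 1 (mod p)`, `v ∤ p` a finite place with local Galois group `Γ_{K_v}`, local subgroup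
`H = Gal(K̄_v/(K_∞)_η)` and `𝒫_v = H¹(H, E(K̄_v))`; `g ∈ Γ_{K_v}` with `κ(g|_{K̄}) = N` (ADMISSIBLE: `γ^N ∈ ker κ · g|_{K̄}`) and of
maximal norm (GENERATING). Then every `p`-power-torsion `z ∈ 𝒫_v` with `u^N · conj_g z = z` satisfies: there is `J₀` such that for
every `J ≥ J₀` some `t ∈ H¹(Γ_{K_v}, E[p^J](χ_u))` has `twistedTorsionToLocalH1 t = z` — the hypothesis `hloc` of
`SignedEC.TwistedSurj.twistedCassels_sharp_of_level`. See the module docstring for the five steps.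
[cite: GreenbergLNM1716, §4 proof of Lemma 4.7 (p. 108) and pp. 122–124; §2 Prop. 2.1 (p. 72)] [cite: SerreGaloisCohomology1997, I §2.6 (b), I §5] -/
theorem exists_twistedTorsionToLocalH1_eq_of_zsmul_conjH1_eq {u : ℤ} (hu : (p : ℤ) ∣ u - 1)
    (v : HeightOneSpectrum (𝓞 K)) (hpv : ((p : ℕ) : 𝓞 K) ∉ v.asIdeal) {N : ℕ}
    {g : absoluteGaloisGroup (v.adicCompletion K)}
    (hgN : κ (resGal (K := K) (v.adicCompletion K) g) = Multiplicative.ofAdd (N : ℤ_[p]))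
    (hg0 : resGal (K := K) (v.adicCompletion K) g ∉ κ.kerSubgroup)
    (hmax : ∀ σ : absoluteGaloisGroup (v.adicCompletion K),
      ‖(κ (resGal (K := K) (v.adicCompletion K) σ)).toAdd‖ ≤ ‖(κ (resGal (K := K) (v.adicCompletion K) g)).toAdd‖)
    (z : discreteH1 (localSubgroup κ.kerSubgroup (v.adicCompletion K)) (localPoints W (v.adicCompletion K)))
    (hz : ∃ k : ℕ, p ^ k • z = 0)
    (heig : u ^ N • Literature.NumberTheory.EllipticCurves.conjH1 (localSubgroup κ.kerSubgroup (v.adicCompletion K))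
        (localPoints W (v.adicCompletion K)) g z = z) :
    ∃ J₀ : ℕ, ∀ J : ℕ, J₀ ≤ J →
      ∃ t : galoisCohomology ((W.twistedTorsionGaloisModule p κ J u hu).restrictField (v.adicCompletion K)) 1,
        W.twistedTorsionToLocalH1 p κ J u hu (v.adicCompletion K) t = z := by
  -- notation
  let E : Type u := v.adicCompletion K
  let G : Type u := absoluteGaloisGroup (v.adicCompletion K)
  let Pt : Type u := localPoints W (v.adicCompletion K)
  let Hi : Subgroup G := localSubgroup κ.kerSubgroup (v.adicCompletion K)
  change ∃ J₀ : ℕ, ∀ J : ℕ, J₀ ≤ J →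
      ∃ t : galoisCohomology ((W.twistedTorsionGaloisModule p κ J u hu).restrictField E) 1,
        W.twistedTorsionToLocalH1 p κ J u hu E t = z
  -- (1) the local `ℤ_p`-extension `κE` with `ker κE = H_∞` and topological generator `g`
  obtain ⟨κE, hker, hγE⟩ := exists_zpExtension_kerSubgroup_eq_localSubgroup_of_norm_le κ E hg0 hmax
  haveI : CompactSpace G := absoluteGaloisGroup_compactSpace (v.adicCompletion K)
  haveI : CharZero E := charZero_of_injective_algebraMap (algebraMap K (v.adicCompletion K)).injective
  have hkerι : ∀ τ : G, τ ∈ κE.kerSubgroup ↔ τ ∈ Hi := fun τ ↦ by rw [hker]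
  have galois_smul_nsmul : ∀ (τ : G) (n : ℕ) (P : Pt), τ • (n • P) = n • (τ • P) :=
    fun τ n P ↦ map_nsmul (DistribSMul.toAddMonoidHom Pt τ) n P
  have galois_smul_zsmul : ∀ (τ : G) (n : ℤ) (P : Pt), τ • (n • P) = n • (τ • P) :=
    fun τ n P ↦ map_zsmul (DistribSMul.toAddMonoidHom Pt τ) n P
  -- (2) a cocycle `φ` for `z`; `p^k φ = ∂Q`, `Q = p^k Q'`
  obtain ⟨φ, rfl⟩ := oneCocycleClass_surjective (discreteTopRep Hi Pt) z
  obtain ⟨k, hk⟩ := hz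
  have hk' : oneCocycleClass (discreteTopRep Hi Pt) (p ^ k • φ) = 0 := by
    rw [← oneCocycleClassₗ_apply, map_nsmul, oneCocycleClassₗ_apply, hk]
  rw [oneCocycleClass_eq_zero_iff] at hk'
  obtain ⟨Q, hQ⟩ := hk'
  have hQ' : ∀ τ : Hi, p ^ k • φ.1 τ = (τ : G) • Q - Q := fun τ ↦ by
    have h := hQ τ
    rw [Submodule.coe_smul_of_tower, ContinuousMap.smul_apply, discreteTopRep_ρ_apply,
      Subgroup.smul_def] at h
    exact h
  have hpk : ((p ^ k : ℕ) : ℤ) ≠ 0 := by exact_mod_cast pow_ne_zero _ (Fact.out : p.Prime).ne_zero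
  obtain ⟨Q', hQQ'⟩ : ∃ Q' : Pt, ((p ^ k : ℕ) : ℤ) • Q' = Q :=
    (W.baseChange (AlgebraicClosure (v.adicCompletion K))).zsmul_surjective_of_isAlgClosed hpk Q
  rw [natCast_zsmul] at hQQ'
  -- the torsion-valued cocycle `f = φ - ∂Q'`
  let f : ∀ τ : G, τ ∈ Hi → Pt := fun τ hτ ↦ φ.1 ⟨τ, hτ⟩ - (τ • Q' - Q')
  have hfdef : ∀ τ hτ, f τ hτ = φ.1 ⟨τ, hτ⟩ - (τ • Q' - Q') := fun _ _ ↦ rfl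
  have hfk : ∀ τ hτ, p ^ k • f τ hτ = 0 := fun τ hτ ↦ by
    rw [hfdef, smul_sub, hQ' ⟨τ, hτ⟩, smul_sub, ← galois_smul_nsmul, hQQ', sub_self]
  have hfmul : ∀ (σ τ : G) (hσ : σ ∈ Hi) (hτ : τ ∈ Hi),
      f (σ * τ) (mul_mem hσ hτ) = f σ hσ + σ • f τ hτ := by
    intro σ τ hσ hτ
    have h := φ.2 ⟨σ, hσ⟩ ⟨τ, hτ⟩
    have hst : (⟨σ * τ, mul_mem hσ hτ⟩ : Hi) = ⟨σ, hσ⟩ * ⟨τ, hτ⟩ := rfl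
    simp only [hfdef]
    rw [hst, h, discreteTopRep_ρ_apply, Subgroup.smul_def, smul_sub, smul_sub, mul_smul]
    change φ.1 ⟨σ, hσ⟩ + σ • φ.1 ⟨τ, hτ⟩ - (σ • τ • Q' - Q') =
      φ.1 ⟨σ, hσ⟩ - (σ • Q' - Q') + (σ • φ.1 ⟨τ, hτ⟩ - (σ • τ • Q' - σ • Q'))
    abel
  -- (3) the TWISTED `g`-invariance of `[φ]`: `u^N · g φ(g⁻¹ τ g) - φ(τ) = ∂R₀`
  have hcσ : ∀ (x : Hi) (m : Pt), DistribSMul.toAddMonoidHom Pt g (subgroupConj Hi g x • m) =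
      x • DistribSMul.toAddMonoidHom Pt g m := fun x m ↦ by
    simp only [DistribSMul.toAddMonoidHom_apply, Subgroup.smul_def, subgroupConj_apply_coe, smul_smul,
      mul_assoc, mul_inv_cancel_left]
  let ψg : contOneCocycles (discreteTopRep Hi Pt) := contOneCocycles.pullback (subgroupConj Hi g)
    (resHomOfEquivariant (subgroupConj Hi g) (DistribSMul.toAddMonoidHom Pt g) hcσ) φ
  have hconj : Literature.NumberTheory.EllipticCurves.conjH1 Hi Pt g (oneCocycleClass _ φ) = oneCocycleClass _ ψg :=
    map_oneCocycleClass _ _ _ φ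
  have hinv0 := heig
  rw [hconj] at hinv0
  have hinv1 : oneCocycleClass (discreteTopRep Hi Pt) ((u ^ N : ℤ) • ψg) = oneCocycleClass _ φ := by
    rw [← oneCocycleClassₗ_apply (φ := ψg), ← map_zsmul, oneCocycleClassₗ_apply] at hinv0
    exact hinv0
  have hinv : oneCocycleClass (discreteTopRep Hi Pt) ((u ^ N : ℤ) • ψg - φ) = 0 := by
    rw [oneCocycleClass_sub, sub_eq_zero]; exact hinv1
  rw [oneCocycleClass_eq_zero_iff] at hinv
  obtain ⟨R₀, hR₀⟩ := hinv
  have hgc : ∀ τ, τ ∈ Hi → g⁻¹ * τ * g ∈ Hi := fun τ hτ ↦ conj_mem_of_normal Hi g ⟨τ, hτ⟩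
  have hR₀' : ∀ (τ : G) (hτ : τ ∈ Hi),
      u ^ N • (g • φ.1 ⟨g⁻¹ * τ * g, hgc τ hτ⟩) - φ.1 ⟨τ, hτ⟩ = τ • R₀ - R₀ := by
    intro τ hτ
    have h := hR₀ ⟨τ, hτ⟩
    rw [Submodule.coe_sub, Submodule.coe_smul, ContinuousMap.sub_apply, ContinuousMap.smul_apply,
      contOneCocycles.pullback_apply, discreteTopRep_ρ_apply, Subgroup.smul_def] at h
    exact h
  -- `u^N · g f(g⁻¹ τ g) - f(τ) = ∂P₀` with `P₀ = R₀ - u^N · g Q' + Q'`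
  obtain ⟨P₀, hP₀def⟩ : ∃ P₀ : Pt, P₀ = R₀ - u ^ N • (g • Q') + Q' := ⟨_, rfl⟩
  have htwist : ∀ (τ : G) (hτ : τ ∈ Hi),
      u ^ N • (g • f (g⁻¹ * τ * g) (hgc τ hτ)) - f τ hτ = τ • P₀ - P₀ := by
    intro τ hτ
    have e1 := hR₀' τ hτ
    have e2 : g • ((g⁻¹ * τ * g) • Q') = τ • g • Q' := by
      rw [← mul_smul, ← mul_smul, ← mul_assoc, ← mul_assoc, mul_inv_cancel, one_mul]
    rw [hfdef, hfdef, smul_sub g, smul_sub g, e2, hP₀def, smul_sub (u ^ N), smul_sub (u ^ N), smul_add τ, smul_sub τ,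
      galois_smul_zsmul τ]
    calc u ^ N • g • φ.1 ⟨g⁻¹ * τ * g, hgc τ hτ⟩ - (u ^ N • τ • g • Q' - u ^ N • g • Q') -
          (φ.1 ⟨τ, hτ⟩ - (τ • Q' - Q'))
        = (u ^ N • g • φ.1 ⟨g⁻¹ * τ * g, hgc τ hτ⟩ - φ.1 ⟨τ, hτ⟩) - (u ^ N • τ • g • Q' - u ^ N • g • Q') +
            (τ • Q' - Q') := by abel
      _ = (τ • R₀ - R₀) - (u ^ N • τ • g • Q' - u ^ N • g • Q') + (τ • Q' - Q') := by rw [e1]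
      _ = τ • R₀ - u ^ N • τ • g • Q' + τ • Q' - (R₀ - u ^ N • g • Q' + Q') := by abel
  -- `a = p^k P₀` is fixed by `H_∞`
  set Mi : AddSubgroup Pt := FixedPoints.addSubgroup Hi Pt with hMi
  have ha : p ^ k • P₀ ∈ Mi := by
    rintro ⟨τ, hτ⟩
    change τ • (p ^ k • P₀) = p ^ k • P₀
    have h1 : p ^ k • (τ • P₀ - P₀) = 0 := by
      rw [← htwist τ hτ, smul_sub, smul_comm (p ^ k) (u ^ N), ← galois_smul_nsmul g, hfk, hfk, smul_zero,
        smul_zero, sub_zero]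
    rw [smul_sub, ← galois_smul_nsmul, sub_eq_zero] at h1
    exact h1
  -- (4) KUMMER VANISHING at `v ∤ p`
  obtain ⟨R, hR⟩ := PrimaryCoinvariants.exists_sub_pow_smul_mem p
    (Greenberg1999.exists_sub_smul_mem_primaryComponent_fixedPoints_localSubgroup W κ v hpv) k ⟨p ^ k • P₀, ha⟩
  rw [PrimaryCoinvariants.mem_primaryComponent_iff_exists_nsmul] at hR
  obtain ⟨m₁, hm₁⟩ := hR
  have hm₁' : p ^ m₁ • (p ^ k • P₀ - p ^ k • ((R : Mi) : Pt)) = 0 := by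
    have h := congrArg (fun z : Mi ↦ (z : Pt)) hm₁
    simpa only [AddSubgroupClass.coe_nsmul, AddSubgroupClass.coe_sub, ZeroMemClass.coe_zero] using h
  set P' : Pt := P₀ - ((R : Mi) : Pt) with hP'def
  have hP'tors : p ^ (m₁ + k) • P' = 0 := by
    rw [hP'def, pow_add, mul_smul, smul_sub (p ^ k), hm₁']
  have hRfix : ∀ (τ : G), τ ∈ Hi → τ • ((R : Mi) : Pt) = ((R : Mi) : Pt) := fun τ hτ ↦ R.2 ⟨τ, hτ⟩
  have htwist' : ∀ (τ : G) (hτ : τ ∈ Hi),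
      u ^ N • (g • f (g⁻¹ * τ * g) (hgc τ hτ)) - f τ hτ = τ • P' - P' := by
    intro τ hτ
    rw [htwist τ hτ, hP'def, smul_sub τ, hRfix τ hτ]
    abel
  -- (5) the level `J ≥ J₀ := m₁ + k`: transport to `E[p^J](K̄)` with the TWISTED action and extend (`cd_p ℤ_p = 1`)
  refine ⟨m₁ + k, fun J hJ ↦ ?_⟩
  have hpJ : ((p ^ J : ℕ) : ℤ) ≠ 0 := by exact_mod_cast pow_ne_zero _ (Fact.out : p.Prime).ne_zero
  -- `f` and `P'` are `p^J`-torsion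
  have hfJ : ∀ τ hτ, f τ hτ ∈ AddSubgroup.torsionBy Pt ((p ^ J : ℕ) : ℤ) := fun τ hτ ↦
    AddSubgroup.torsionBy.nsmul_iff.mpr (by
      rw [show J = (J - k) + k by omega, pow_add, mul_smul, hfk, smul_zero])
  have hP'J : P' ∈ AddSubgroup.torsionBy Pt ((p ^ J : ℕ) : ℤ) :=
    AddSubgroup.torsionBy.nsmul_iff.mpr (by
      rw [show J = (J - (m₁ + k)) + (m₁ + k) by omega, pow_add, mul_smul, hP'tors, smul_zero])
  -- the torsion comparison `θ : E[p^J](K̄) ≃ E(K̄_v)[p^J]` and the twisted local module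
  let M : Type u := ↥(geomTorsion W ((p ^ J : ℕ) : ℤ))
  let θ : M ≃+ AddSubgroup.torsionBy Pt ((p ^ J : ℕ) : ℤ) := W.torsionPointsEquiv ((p ^ J : ℕ) : ℤ) (E := E) hpJ
  let ρE := (W.twistedTorsionGaloisModule p κ J u hu).restrictField E
  letI instM : DistribMulAction G M := DistribMulAction.compHom M ρE.toRepresentation
  have hsmulM : ∀ (σ : G) (m : M), σ • m = (u ^ κ.twistExponent J (resGal (K := K) E σ)) • (resGal (K := K) E σ • m) :=
    fun σ m ↦ by
      show (W.twistedTorsionGaloisModule p κ J u hu) (resGal (K := K) E σ) m = _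
      rw [ZpExtension.galoisTwist_apply_apply, torsionGaloisModule_apply_apply]
  have hMtors : ∀ m : M, p ^ J • m = 0 := W.pow_nsmul_geomTorsion_pow p J
  -- on `H_∞ = ker κE` the twist is invisible
  have hsmulH : ∀ (τ : G), τ ∈ Hi → ∀ m : M, τ • m = resGal (K := K) E τ • m := fun τ hτ m ↦ by
    rw [hsmulM, κ.twistExponent_eq_zero_of_mem_kerSubgroup ((mem_localSubgroup_iff _ _ τ).mp hτ), pow_zero, one_smul]
  -- `g` acts through `u^N`
  have hsmulg : ∀ m : M, g • m = u ^ N • (resGal (K := K) E g • m) := fun m ↦ by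
    rw [hsmulM, twistExponent_eq_mod_of_apply_eq κ J hgN, ZpExtension.pow_mod_zsmul_eq hMtors hu]
  -- `θ⁻¹` is equivariant for the UNTWISTED actions
  have hθ : ∀ (σ : G) (T : AddSubgroup.torsionBy Pt ((p ^ J : ℕ) : ℤ)),
      θ.symm (σ • T) = resGal (K := K) E σ • θ.symm T := fun σ T ↦ W.torsionPointsEquiv_symm_smul _ hpJ σ T
  have hθval : ∀ T : AddSubgroup.torsionBy Pt ((p ^ J : ℕ) : ℤ), pointsMap W E ((θ.symm T : M) : geomPoints W) = (T : Pt) :=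
    fun T ↦ W.pointsMap_torsionPointsEquiv_symm _ hpJ T
  have hcontM : ∀ m : M, Continuous fun σ : G ↦ σ • m := fun m ↦ ρE.continuous_apply_left m
  have hprimM : ∀ m : M, ∃ n : ℕ, p ^ n • m = 0 := fun m ↦ ⟨J, hMtors m⟩
  -- the `M`-valued cocycle `cT` on `ker κE`
  have hkE : ∀ τ : κE.kerSubgroup, (τ : G) ∈ Hi := fun τ ↦ (hkerι τ).mp τ.2
  have hφcont : Continuous fun τ : κE.kerSubgroup ↦ φ.1 ⟨τ, hkE τ⟩ :=
    φ.1.continuous.comp (continuous_subtype_val.subtype_mk _)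
  have hKcont : Continuous fun τ : κE.kerSubgroup ↦ (τ : G) • Q' - Q' :=
    (continuous_of_discreteTopology (f := fun q : Pt ↦ q - Q')).comp
      ((continuous_smul_localPoints W (v.adicCompletion K) Q').comp continuous_subtype_val)
  have hfcont : Continuous fun τ : κE.kerSubgroup ↦ f τ (hkE τ) :=
    (continuous_of_discreteTopology (f := fun q : Pt × Pt ↦ q.1 - q.2)).comp (hφcont.prodMk hKcont)
  let fT : κE.kerSubgroup → AddSubgroup.torsionBy Pt ((p ^ J : ℕ) : ℤ) := fun τ ↦ ⟨f τ (hkE τ), hfJ τ (hkE τ)⟩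
  have hfTcont : Continuous fT := hfcont.subtype_mk _
  let cT : contOneCocycles (discreteTopRep κE.kerSubgroup M) :=
    ⟨⟨fun τ ↦ θ.symm (fT τ), (continuous_of_discreteTopology (f := θ.symm)).comp hfTcont⟩, fun σ τ ↦ by
      change θ.symm (fT (σ * τ)) = θ.symm (fT σ) + (σ : G) • θ.symm (fT τ)
      rw [hsmulH _ (hkE σ), ← hθ, ← map_add]
      congr 1
      apply Subtype.ext
      rw [AddSubgroup.coe_add, AddSubgroup.torsionBy.coe_smul]
      exact hfmul σ τ (hkE σ) (hkE τ)⟩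
  have hcT : ∀ τ : κE.kerSubgroup, cT.1 τ = θ.symm (fT τ) := fun _ ↦ rfl
  let mT : M := θ.symm ⟨P', hP'J⟩
  have hm : ∀ τ : κE.kerSubgroup, g ^ p ^ 0 • cT.1 (subgroupConj κE.kerSubgroup (g ^ p ^ 0) τ) - cT.1 τ =
      (τ : G) • mT - mT := by
    intro τ
    have hg1 : g ^ p ^ 0 = g := by rw [pow_zero, pow_one]
    have hconjτ : subgroupConj κE.kerSubgroup (g ^ p ^ 0) τ =
        ⟨g⁻¹ * τ * g, (hkerι _).mpr (hgc τ (hkE τ))⟩ := Subtype.ext (by rw [subgroupConj_apply_coe, hg1])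
    rw [hconjτ, hg1, hcT, hcT, hsmulg, hsmulH _ (hkE τ), ← hθ, ← hθ, ← map_zsmul, ← map_sub, ← map_sub]
    congr 1
    apply Subtype.ext
    rw [AddSubgroup.coe_sub, AddSubgroup.coe_sub, AddSubgroupClass.coe_zsmul, AddSubgroup.torsionBy.coe_smul,
      AddSubgroup.torsionBy.coe_smul]
    exact htwist' τ (hkE τ)
  obtain ⟨bc, hbc⟩ := ZpExtension.exists_extend κE hγE 0 hcontM hprimM cT mT hm
  -- the extended cocycle as a cocycle of the twisted local module on all of `Γ_{K_v} = κE⁻¹(p⁰ ℤ_p)`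
  have htop : ∀ σ : G, σ ∈ κE.layerSubgroup 0 := fun σ ↦ by
    rw [ZpExtension.layerSubgroup_zero]; exact Subgroup.mem_top σ
  let ξ : contOneCocycles ρE.toTopRep :=
    ⟨⟨fun σ ↦ (bc.1 ⟨σ, htop σ⟩ : M), bc.1.continuous.comp (continuous_id.subtype_mk _)⟩, fun σ τ ↦ by
      change bc.1 ⟨σ * τ, htop _⟩ = bc.1 ⟨σ, htop σ⟩ + ρE.toTopRep.ρ σ (bc.1 ⟨τ, htop τ⟩)
      rw [ContinuousRep.toTopRep_ρ_apply]
      have h := bc.2 ⟨σ, htop σ⟩ ⟨τ, htop τ⟩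
      rw [discreteTopRep_ρ_apply, Subgroup.smul_def] at h
      exact h⟩
  refine ⟨oneCocycleClass _ ξ, ?_⟩
  rw [twistedTorsionToLocalH1_oneCocycleClass, ← sub_eq_zero, ← oneCocycleClass_sub, oneCocycleClass_eq_zero_iff]
  refine ⟨-Q', fun τ ↦ ?_⟩
  have hτE : (τ : G) ∈ κE.kerSubgroup := (hkerι _).mpr τ.2
  have e2 : (⟨(τ : G), τ.2⟩ : Hi) = τ := rfl
  rw [Submodule.coe_sub, ContinuousMap.sub_apply, contOneCocycles.pullback_apply, discreteTopRep_ρ_apply, Subgroup.smul_def]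
  change pointsMap W E (((bc.1 ⟨(τ : G), htop _⟩ : M) : geomPoints W)) - φ.1 τ = (τ : G) • (-Q') - -Q'
  have hb : bc.1 ⟨(τ : G), htop _⟩ = cT.1 ⟨τ, hτE⟩ := by
    have h := hbc (τ : G) hτE
    have e3 : (⟨(τ : G), κE.kerSubgroup_le_layerSubgroup 0 hτE⟩ : κE.layerSubgroup 0) = ⟨(τ : G), htop _⟩ := rfl
    rw [← e3, h]
  rw [hb, hcT, hθval]
  change f τ (hkE ⟨τ, hτE⟩) - φ.1 τ = (τ : G) • (-Q') - -Q'
  rw [hfdef, e2, smul_neg]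
  abel

end Summit.BirchSwinnertonDyer.BirchSwinnertonDyer.Theorems.SignedEC.TwistedLocalDescent

end
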